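import Literature.AnabelianGeometry.EtaleTheta.Discharge.Sec2BarDeltaIndex
import Literature.AnabelianGeometry.EtaleTheta.SettingModelChiThetaDoubleUnderline
import Literature.AnabelianGeometry.EtaleTheta.SettingModelChiThetaCocycleSec
import HarnessLib

/-!
# GAP row G-L2d3-7 «Π^tp_{X̲̲} ⊇ Ker(Δ^tp_X ↠ Δ̄_X)» HOLDS at the χ-model: `barKerTp l ≤ Huuχ p l` for odd `l`
# (proof-only NV one-liner asked by abc-iut-L2-lead, R419)

Mochizuki, *The étale theta function …*, Publ. RIMS **45** (2009) [EtTh], Prop. 2.2 (i)/(ii) p. 37 («the inverse image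
`E ⊆ Δ_{X̲}` … `Ker ⊆ E`», «`Π_{X̲̲} := S · E`»), Def. 2.1 p. 35 (`Δ̄_X = Δ^Θ_X/⟨l-th powers⟩`), Def. 2.5 (i) p. 39
[cite: MochizukiEtTh2009, Prop 2.2 (ii) p.37].  abc-iut cell, layer L2, prover abc-iut-L2-d1 (gen 5); PROOF-ONLY NV of
abc-iut-L2-d3's binder `hK : M.barKerTp l ≤ C.Huu` (GAP G-L2d3-7, `ThetaCoversTemperedOfHuu` / `Sec2HuuClosureModel`) at the
constructor site `X̲̲ := Huuχ p l = dUU l ⋊ G_{ℚ_p}` of abc-iut-L2-t1's `modelχ` (`dUU l = {γ : ĥ_l(γ).x = ĥ_l(γ).z = 0}`):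

* `Heis.pow_eq_mk` — the Heisenberg power law `(x, y, z)^n = (nx, ny, nz + C(n,2)·xy)`; `Heis.pow_eq_one_of_odd` — for
  odd `l` the level-`l` Heisenberg group has exponent `l` (`C(l,2) = l·(l−1)/2 ≡ 0`); hence `levelHom_pow_eq_one_of_odd`,
  `pow_mem_dUU_of_odd` (`γ^l ∈ dUU l` for EVERY `γ ∈ Γ`);
* `thetaKer_le_Huuχ` — `Ker(Π^tp_X ↠ (Π^tp_X)^Θ) ≤ Π^tp_X̲̲` (level-trivial);
* **`barKerTp_le_Huuχ`** — for odd `l`, `Ker(Δ^tp_X ↠ Δ̄_X) ≤ Π^tp_X̲̲`: by abc-iut's normal form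
  `exists_pow_mul_of_mem_powTheta` (`⟨l-th powers⟩ = {t^l · z : t ∈ (Δ^tp_X)^Θ, z ∈ l·Δ_Θ}`, `Sec2BarDeltaIndex`), an element
  of the kernel is `θ(g₀^l · h)` modulo `Ker θ` with `g₀ ∈ Δ^tp_X` (so `g₀^l ∈ Π^tp_X̲̲` by the exponent law) and
  `θ(h) ∈ l·Δ_Θ = θ(Π^tp_X̲̲) ∩ Δ_Θ` (this seat's `map_toTheta_Huuχ_modelχ`);
* `barKerTp_le_Huu_doubleUnderlineχSec` — the record form for `C := doubleUnderlineχSec p l hl`.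
SEMI-SYNTHETIC MODEL, consistency evidence only; nothing of [EtTh] asserted; no side taken on [IUTchIII] Cor. 3.12.
-/

noncomputable section

namespace Literature.AnabelianGeometry.EtaleTheta.SettingModel

open Literature.AnabelianGeometry.SemiGraphs _root_.Function

/-! ### The Heisenberg power law and the exponent of the level-`l` group -/

/-- **`(x, y, z)^n = (n·x, n·y, n·z + C(n,2)·x·y)`** in the Heisenberg group. [cite: MochizukiEtTh2009, §1 p.12] -/
theorem Heis.pow_eq_mk {R : Type*} [CommRing R] (a : Heis R) (n : ℕ) :
    a ^ n = ⟨(n : R) * a.x, (n : R) * a.y, (n : R) * a.z + ((n.choose 2 : ℕ) : R) * (a.x * a.y)⟩ := by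
  induction n with
  | zero => ext <;> simp
  | succ n ih =>
    rw [pow_succ, ih]
    ext
    · rw [Heis.mul_x]; push_cast; ring
    · rw [Heis.mul_y]; push_cast; ring
    · rw [Heis.mul_z, Nat.choose_succ_succ, Nat.choose_one_right]; push_cast; ring

/-- **For odd `l` the level-`l` Heisenberg group `Heis(ℤ/l)` has exponent `l`** (`l ≡ 0`, `C(l,2) = l·(l−1)/2 ≡ 0`).
[cite: MochizukiEtTh2009, Def 2.1 p.35] -/
theorem Heis.pow_eq_one_of_odd (l : ℕ+) (hl : Odd (l : ℕ)) (a : Heis (ZMod l)) : a ^ (l : ℕ) = 1 := by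
  obtain ⟨k, hk⟩ := hl
  have hchoose : (l : ℕ).choose 2 = l * k := by
    rw [Nat.choose_two_right, hk]
    have h2 : (2 * k + 1) * (2 * k + 1 - 1) = 2 * ((2 * k + 1) * k) := by
      rw [Nat.add_sub_cancel]; ring
    rw [h2, Nat.mul_div_cancel_left _ (by norm_num : 0 < 2)]
  rw [Heis.pow_eq_mk, hchoose, Nat.cast_mul, ZMod.natCast_self]
  ext <;> simp

variable (p : ℕ) [Fact p.Prime] (l : ℕ+) (hl : Odd (l : ℕ))

include hl in
/-- `ĥ_l(γ^l) = 1` for EVERY `γ ∈ Γ` (odd `l`). [cite: MochizukiEtTh2009, Def 2.1 p.35] -/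
theorem levelHom_pow_eq_one_of_odd (γ : Gfp) : levelHom l (γ ^ (l : ℕ)) = 1 := by
  rw [map_pow, Heis.pow_eq_one_of_odd l hl]

include hl in
/-- `γ^l ∈ dUU l` for every `γ ∈ Γ` (odd `l`). [cite: MochizukiEtTh2009, Def 2.5 (i) p.39] -/
theorem pow_mem_dUU_of_odd (γ : Gfp) : γ ^ (l : ℕ) ∈ dUU l := by
  rw [mem_dUU_iff, levelHom_pow_eq_one_of_odd l hl]
  exact ⟨rfl, rfl⟩

/-! ### `Ker(Δ^tp_X ↠ Δ̄_X) ≤ Π^tp_X̲̲` at the χ-model -/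

/-- `Ker(Π^tp_X ↠ (Π^tp_X)^Θ) ≤ Π^tp_X̲̲`: its elements have trivial levels (and trivial Galois component).
[cite: MochizukiEtTh2009, Def 2.5 (i) p.39] -/
theorem thetaKer_le_Huuχ : CurveTheta.thetaKer (curveχ p) ≤ Huuχ p l := fun x hx => by
  obtain ⟨hlev, -⟩ := (mem_thetaKerχ_iff p x).mp hx
  rw [mem_Huuχ_iff]
  have h1 : levelHom l x.left = 1 := hlev l
  rw [h1]
  exact ⟨rfl, rfl⟩

include hl in
/-- **GAP row G-L2d3-7 at the χ-model: `Ker(Δ^tp_X ↠ Δ̄_X) ≤ Π^tp_X̲̲`** for odd `l` — the chosen covering `X̲̲ → X`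
lies over the `Δ̄_X`-level. [cite: MochizukiEtTh2009, Prop 2.2 (ii) p.37] -/
theorem barKerTp_le_Huuχ : (ThetaSetting.modelχ p).barKerTp l ≤ Huuχ p l := by
  intro g hg
  obtain ⟨hgΔ, hgpow⟩ := (ThetaSetting.mem_barKerTp_iff (D := ThetaSetting.modelχ p) (l := (l : ℕ))).mp hg
  obtain ⟨t, ht, z, hz, hq⟩ := ThetaSetting.exists_pow_mul_of_mem_powTheta (D := ThetaSetting.modelχ p) (l : ℕ) hl hgpow
  obtain ⟨g₀, hg₀, rfl⟩ := ht
  have hr₀ : g₀.right = 1 := (mem_deltaTempχ_iff p g₀).mp hg₀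
  have hg₀' : g₀ = SemidirectProduct.inl g₀.left := by
    rw [← SemidirectProduct.inl_left_mul_inr_right g₀, hr₀, map_one, mul_one]
    rfl
  have hz' : z ∈ (Huuχ p l).map (ThetaSetting.modelχ p).toTheta ⊓ (ThetaSetting.modelχ p).DeltaTheta := by
    rw [map_toTheta_Huuχ_modelχ]
    exact hz
  obtain ⟨h, hh, rfl⟩ := (Subgroup.mem_inf.mp hz').1
  have hw : g₀ ^ (l : ℕ) * h ∈ Huuχ p l := by
    refine mul_mem ?_ hh
    rw [hg₀', ← map_pow, inl_mem_Huuχ_iff]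
    exact pow_mem_dUU_of_odd l hl _
  have hq' : CurveTheta.toTheta (curveχ p) g = CurveTheta.toTheta (curveχ p) (g₀ ^ (l : ℕ) * h) := by
    rw [map_mul, map_pow]
    exact hq
  rw [CurveTheta.toTheta, QuotientGroup.mk'_apply, QuotientGroup.mk'_apply, QuotientGroup.eq_iff_div_mem] at hq'
  rw [← div_mul_cancel g (g₀ ^ (l : ℕ) * h)]
  exact mul_mem (thetaKer_le_Huuχ p l hq') hw

include hl in
/-- The record form: for the choice `C := doubleUnderlineχSec p l hl` of `X̲̲` at the χ-model (abc-iut-L2-t8's capstone datum),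
`Ker(Δ^tp_X ↠ Δ̄_X) ≤ C.Huu` — abc-iut-L2-d3's binder `hK` DISCHARGED at the constructor site. [cite: MochizukiEtTh2009, Prop 2.2 (ii) p.37] -/
theorem barKerTp_le_Huu_doubleUnderlineχSec :
    (ThetaSetting.modelχ p).barKerTp l ≤ (doubleUnderlineχSec p l hl).Huu :=
  barKerTp_le_Huuχ p l hl

end Literature.AnabelianGeometry.EtaleTheta.SettingModel

end
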